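import Summits.Ventures.PackingBounds.Configurations.GroundStateSeries
import Summits.Ventures.PackingBounds.Configurations.SimplexEnergyRigidity
import Summits.Ventures.PackingBounds.Configurations.CrossPolytopeEnergyRigidity
import Summits.Ventures.PackingBounds.Energy.UniversalOptimalitySimplex
import Summits.Ventures.PackingBounds.Energy.UniversalOptimalityCrossPolytope

/-!
# Simplex and cross-polytope: uniqueness of the ground state for absolutely monotone and Riesz potentials

Framing: lottery ticket; floor = certified bounds/negative ranges. Venture `PackingBounds` (cell
`pub-packcert`, seat `pub-packcert-energy`) — Cohn–Kumar Table 1, the simplex and cross-polytope rows (all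
dimensions `n ≥ 3`): the uniqueness clause of Cohn–Kumar's Theorem 1.2 in full strength.

`SimplexEnergyRigidity.isometric_of_ckPow_energy_le` / `CrossPolytopeUnique.isometric_of_ckPow_energy_le` prove that
two configurations attaining the universal `(1+t)^k` bound (`k ≥ 2`, resp. `k ≥ 3`) are isometric. With the universal
bounds for every `k` (`Energy.UniversalSimplex.ckPow_energy_ge`, `Energy.UniversalCrossPolytope.ckPow_energy_ge`) and
`GroundStateSeries`: **any two `N`-point (`2 ≤ N ≤ n+1`), resp. `2n`-point, configurations on `S^{n-1}` minimising
the `a`-energy of an absolutely monotone `a` with `a^(k)(-1) > 0` for some `k ≥ 2`, resp. `k ≥ 3`, are isometric**;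
in particular any two minimisers of a Riesz energy `Σ |x-y|^(-2p)`, `p > 0`, are isometric
(`Simplex.riesz_ground_states_isometric`, `CrossPolytope.riesz_ground_states_isometric`).

## References
* H. Cohn, A. Kumar, J. Amer. Math. Soc. 20 (2007) 99–148, Theorem 1.2 and Table 1. [`CohnKumar2006`]
-/

noncomputable section

namespace Summit.Ventures.PackingBounds.Config

open Finset Set

namespace SimplexGroundState

variable {n N : ℕ} (hn : 3 ≤ n) (hN2 : 2 ≤ N)
include hn hN2

/-- An `a`-energy minimiser among `N` points has the simplex `(1+t)^k`-energy whenever `a^(k)(-1) > 0`. -/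
theorem ckPow_energy_eq_of_absolutelyMonotoneOn {C : Finset (EuclideanSpace ℝ (Fin n))} (h1 : ∀ x ∈ C, ‖x‖ = 1)
    (hN : C.card = N) (a : ℝ → ℝ) (ha : AbsolutelyMonotoneOn a (Ico (-1) 1)) {k : ℕ}
    (hpos : 0 < iteratedDerivWithin k a (Ico (-1) 1) (-1))
    (hE : ∑ x ∈ C, ∑ y ∈ C.erase x, a (inner ℝ x y) = (N : ℝ) * (((N : ℝ) - 1) * a (-1 / ((N : ℝ) - 1)))) :
    ∑ x ∈ C, ∑ y ∈ C.erase x, (1 + inner ℝ x y) ^ k = (N : ℝ) * (((N : ℝ) - 1) * (1 + (-1 / ((N : ℝ) - 1))) ^ k) := by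
  have hN2' : (2 : ℝ) ≤ N := by exact_mod_cast hN2
  have ht : ∀ i : Fin 1, -1 ≤ (![-1 / ((N : ℝ) - 1)] : Fin 1 → ℝ) i ∧ (![-1 / ((N : ℝ) - 1)] : Fin 1 → ℝ) i < 1 := by
    intro i
    fin_cases i
    simp only [Matrix.cons_val_fin_one]
    constructor
    · rw [le_div_iff₀ (by linarith)]; linarith
    · have : (-1 : ℝ) / ((N : ℝ) - 1) < 0 := div_neg_of_neg_of_pos (by norm_num) (by linarith)
      linarith
  have hEB : ∀ j, (N : ℝ) * ∑ i : Fin 1, (![(N : ℝ) - 1] : Fin 1 → ℝ) i *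
      (1 + (![-1 / ((N : ℝ) - 1)] : Fin 1 → ℝ) i) ^ j ≤ ∑ x ∈ C, ∑ y ∈ C.erase x, (1 + inner ℝ x y) ^ j := by
    intro j
    have h := Energy.UniversalSimplex.ckPow_energy_ge hn hN2 j C h1 hN
    simpa using h
  have h := GroundStateSeries.ckPow_energy_eq_of_absolutelyMonotoneOn h1 (N : ℝ) (![-1 / ((N : ℝ) - 1)])
    (![(N : ℝ) - 1]) ht hEB a ha hpos (by rw [hE]; simp)
  rw [h]; simp

/-- **Any two `N`-point minimisers (`2 ≤ N ≤ n + 1`, `n ≥ 3`) of the energy of an absolutely monotone potential with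
`a^(k)(-1) > 0` for some `k ≥ 2` are isometric** (both are regular simplices). [cite: CohnKumar2006, Theorem 1.2] -/
theorem ground_states_isometric_of_absolutelyMonotoneOn (a : ℝ → ℝ) (ha : AbsolutelyMonotoneOn a (Ico (-1) 1))
    (k : ℕ) (hk : 2 ≤ k) (hpos : 0 < iteratedDerivWithin k a (Ico (-1) 1) (-1))
    (C C' : Finset (EuclideanSpace ℝ (Fin n))) (h1 : ∀ x ∈ C, ‖x‖ = 1) (hN : C.card = N)
    (hE : ∑ x ∈ C, ∑ y ∈ C.erase x, a (inner ℝ x y) = (N : ℝ) * (((N : ℝ) - 1) * a (-1 / ((N : ℝ) - 1))))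
    (h1' : ∀ x ∈ C', ‖x‖ = 1) (hN' : C'.card = N)
    (hE' : ∑ x ∈ C', ∑ y ∈ C'.erase x, a (inner ℝ x y) = (N : ℝ) * (((N : ℝ) - 1) * a (-1 / ((N : ℝ) - 1)))) :
    ∃ Ψ : EuclideanSpace ℝ (Fin n) ≃ₗᵢ[ℝ] EuclideanSpace ℝ (Fin n), C' = C.image Ψ := by
  obtain ⟨m, rfl⟩ : ∃ m, k = m + 2 := ⟨k - 2, by omega⟩
  have e := ckPow_energy_eq_of_absolutelyMonotoneOn hn hN2 h1 hN a ha hpos hE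
  have e' := ckPow_energy_eq_of_absolutelyMonotoneOn hn hN2 h1' hN' a ha hpos hE'
  refine isometric_of_ckPow_energy_le m C C' h1 h1' (by rw [hN]; exact hN2) (by rw [hN, hN'])
    ?_ ?_
  · rw [e, hN]; apply le_of_eq; ring
  · rw [e', hN']; apply le_of_eq; ring

/-- **Any two `N`-point minimisers of a Riesz energy `Σ |x-y|^(-2p)` (`p > 0`; `2 ≤ N ≤ n + 1`, `n ≥ 3`) are
isometric.** [cite: CohnKumar2006, Theorem 1.2] -/
theorem riesz_ground_states_isometric (p : ℝ) (hp : 0 < p) (C C' : Finset (EuclideanSpace ℝ (Fin n)))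
    (h1 : ∀ x ∈ C, ‖x‖ = 1) (hN : C.card = N)
    (hE : ∑ x ∈ C, ∑ y ∈ C.erase x, (2 - 2 * inner ℝ x y) ^ (-p) =
      (N : ℝ) * (((N : ℝ) - 1) * (2 - 2 * (-1 / ((N : ℝ) - 1))) ^ (-p)))
    (h1' : ∀ x ∈ C', ‖x‖ = 1) (hN' : C'.card = N)
    (hE' : ∑ x ∈ C', ∑ y ∈ C'.erase x, (2 - 2 * inner ℝ x y) ^ (-p) =
      (N : ℝ) * (((N : ℝ) - 1) * (2 - 2 * (-1 / ((N : ℝ) - 1))) ^ (-p))) :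
    ∃ Ψ : EuclideanSpace ℝ (Fin n) ≃ₗᵢ[ℝ] EuclideanSpace ℝ (Fin n), C' = C.image Ψ :=
  ground_states_isometric_of_absolutelyMonotoneOn hn hN2 (fun t : ℝ => (2 - 2 * t) ^ (-p))
    (Energy.RieszAbsolutelyMonotone.absolutelyMonotoneOn_rpow_chordal p hp.le) 2 le_rfl
    (E8GroundState.iteratedDerivWithin_rpow_chordal_pos p hp 2) C C' h1 hN hE h1' hN' hE'

end SimplexGroundState

namespace CrossPolytopeGroundState

variable {n : ℕ} (hn : 3 ≤ n)
include hn

/-- An `a`-energy minimiser among `2n` points has the cross-polytope `(1+t)^k`-energy whenever `a^(k)(-1) > 0`. -/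
theorem ckPow_energy_eq_of_absolutelyMonotoneOn {C : Finset (EuclideanSpace ℝ (Fin n))} (h1 : ∀ x ∈ C, ‖x‖ = 1)
    (hN : C.card = 2 * n) (a : ℝ → ℝ) (ha : AbsolutelyMonotoneOn a (Ico (-1) 1)) {k : ℕ}
    (hpos : 0 < iteratedDerivWithin k a (Ico (-1) 1) (-1))
    (hE : ∑ x ∈ C, ∑ y ∈ C.erase x, a (inner ℝ x y) = (2 * n : ℝ) * (a (-1) + (2 * n - 2) * a 0)) :
    ∑ x ∈ C, ∑ y ∈ C.erase x, (1 + inner ℝ x y) ^ k = (2 * n : ℝ) * ((1 + (-1 : ℝ)) ^ k + (2 * n - 2) * (1 + (0 : ℝ)) ^ k) := by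
  have ht : ∀ i : Fin 2, -1 ≤ (![-1, 0] : Fin 2 → ℝ) i ∧ (![-1, 0] : Fin 2 → ℝ) i < 1 := by
    intro i; fin_cases i <;> simp
  have hEB : ∀ j, (2 * n : ℝ) * ∑ i : Fin 2, (![1, (2 * n - 2 : ℝ)] : Fin 2 → ℝ) i *
      (1 + (![-1, 0] : Fin 2 → ℝ) i) ^ j ≤ ∑ x ∈ C, ∑ y ∈ C.erase x, (1 + inner ℝ x y) ^ j := by
    intro j
    have h := Energy.UniversalCrossPolytope.ckPow_energy_ge hn j C h1 hN
    simpa [Fin.sum_univ_succ] using h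
  have h := GroundStateSeries.ckPow_energy_eq_of_absolutelyMonotoneOn h1 (2 * n : ℝ) (![-1, 0]) (![1, (2 * n - 2 : ℝ)])
    ht hEB a ha hpos (by rw [hE]; simp [Fin.sum_univ_succ])
  rw [h]; simp [Fin.sum_univ_succ]

/-- **Any two `2n`-point minimisers (`n ≥ 3`) of the energy of an absolutely monotone potential with `a^(k)(-1) > 0`
for some `k ≥ 3` are isometric** (both are cross-polytopes). [cite: CohnKumar2006, Theorem 1.2] -/
theorem ground_states_isometric_of_absolutelyMonotoneOn (a : ℝ → ℝ) (ha : AbsolutelyMonotoneOn a (Ico (-1) 1))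
    (k : ℕ) (hk : 3 ≤ k) (hpos : 0 < iteratedDerivWithin k a (Ico (-1) 1) (-1))
    (C C' : Finset (EuclideanSpace ℝ (Fin n))) (h1 : ∀ x ∈ C, ‖x‖ = 1) (hN : C.card = 2 * n)
    (hE : ∑ x ∈ C, ∑ y ∈ C.erase x, a (inner ℝ x y) = (2 * n : ℝ) * (a (-1) + (2 * n - 2) * a 0))
    (h1' : ∀ x ∈ C', ‖x‖ = 1) (hN' : C'.card = 2 * n)
    (hE' : ∑ x ∈ C', ∑ y ∈ C'.erase x, a (inner ℝ x y) = (2 * n : ℝ) * (a (-1) + (2 * n - 2) * a 0)) :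
    ∃ Ψ : EuclideanSpace ℝ (Fin n) ≃ₗᵢ[ℝ] EuclideanSpace ℝ (Fin n), C' = C.image Ψ := by
  obtain ⟨m, rfl⟩ : ∃ m, k = m + 3 := ⟨k - 3, by omega⟩
  have e := ckPow_energy_eq_of_absolutelyMonotoneOn hn h1 hN a ha hpos hE
  have e' := ckPow_energy_eq_of_absolutelyMonotoneOn hn h1' hN' a ha hpos hE'
  refine CrossPolytopeUnique.isometric_of_ckPow_energy_le hn m C C' h1 hN ?_ h1' hN' ?_
  · rw [e]; apply le_of_eq; norm_num
  · rw [e']; apply le_of_eq; norm_num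

/-- **Any two `2n`-point minimisers of a Riesz energy `Σ |x-y|^(-2p)` (`p > 0`, `n ≥ 3`) are isometric.**
[cite: CohnKumar2006, Theorem 1.2] -/
theorem riesz_ground_states_isometric (p : ℝ) (hp : 0 < p) (C C' : Finset (EuclideanSpace ℝ (Fin n)))
    (h1 : ∀ x ∈ C, ‖x‖ = 1) (hN : C.card = 2 * n)
    (hE : ∑ x ∈ C, ∑ y ∈ C.erase x, (2 - 2 * inner ℝ x y) ^ (-p) =
      (2 * n : ℝ) * ((4 : ℝ) ^ (-p) + (2 * n - 2) * (2 : ℝ) ^ (-p)))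
    (h1' : ∀ x ∈ C', ‖x‖ = 1) (hN' : C'.card = 2 * n)
    (hE' : ∑ x ∈ C', ∑ y ∈ C'.erase x, (2 - 2 * inner ℝ x y) ^ (-p) =
      (2 * n : ℝ) * ((4 : ℝ) ^ (-p) + (2 * n - 2) * (2 : ℝ) ^ (-p))) :
    ∃ Ψ : EuclideanSpace ℝ (Fin n) ≃ₗᵢ[ℝ] EuclideanSpace ℝ (Fin n), C' = C.image Ψ := by
  refine ground_states_isometric_of_absolutelyMonotoneOn hn (fun t : ℝ => (2 - 2 * t) ^ (-p))
    (Energy.RieszAbsolutelyMonotone.absolutelyMonotoneOn_rpow_chordal p hp.le) 3 le_rfl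
    (E8GroundState.iteratedDerivWithin_rpow_chordal_pos p hp 3) C C' h1 hN ?_ h1' hN' ?_
  · rw [hE]; norm_num
  · rw [hE']; norm_num

end CrossPolytopeGroundState

end Summit.Ventures.PackingBounds.Config

end
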